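import Mathlib
import Literature.RingTheory.CohomologyAnnihilator.NoetherDifferentAnnihilator
import Literature.RingTheory.CohomologyAnnihilator.NoetherDifferentUnramified
import Literature.RingTheory.CohomologyAnnihilator.NoetherDifferentSeparable
import Literature.RingTheory.CohomologyAnnihilator.Localization
import Summits.ResolutionOfSingularities.ResolutionOfSingularities.Theorems.HomologicalConductorPersistenceHypersurfaceJacobian
import Summits.ResolutionOfSingularities.ResolutionOfSingularities.Theorems.HomologicalConductorGlobalisationK51CaPullback
import HarnessLib

/-!
# Ascent of cohomology annihilators along module-finite projective separable algebras
# (relative Iyengar–Takahashi 3.3 / 3.4; finite étale ascent; separable base change)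

`[OURS · L1 w44b · idea-2 g4]` — helper for the crux `HomologicalConductor.Persistence`
(stmt-ResolutionOfSingularities-16484) and its surface rung `PersistenceSurface`
(stmt-ResolutionOfSingularities-19970): the "easy maps" half of technique B (which structure of the
cohomology annihilator PERSISTS along which ring maps).  NOT a statement of the manuscript under
adjudication in cell res-hironaka; nothing here is attributed to its author.  Report:
`L/res-L1-w44b-idea-2/ROUND4-ASCENT.md` §1.

**The lemma (OURS; a relative form of [IyengarTakahashi2014, Lemma 3.3 / Prop. 3.4]).** Let `A` be a
commutative noetherian ring and `B` a commutative `A`-algebra that is finitely generated as an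
`A`-module; `𝔑(B/A)` its noether different and `I' = ann_A Ext^{≥1}_A(B, mod A)`.  Then for every `d`

  `𝔑(B/A) · I'ᵈ · caᵈ⁺¹(A) B ⊆ caᵈ⁺¹(B)`

(`noetherDifferent_mul_mem_cohomologyAnnihilatorOfDegree_of_mem`).  Iyengar–Takahashi's Prop. 3.4 is the
case `caᵈ⁺¹(A) = A` (`gldim A ≤ d`).  Consequences:

* `B` projective over `A` (`I' = A`): `𝔑(B/A) · caᵈ⁺¹(A)B ⊆ caᵈ⁺¹(B)`
  (`noetherDifferent_mul_map_le_cohomologyAnnihilatorOfDegree`);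
* `B` projective, module-finite and formally unramified over `A` (e.g. FINITE ÉTALE), so that
  `𝔑(B/A) = B` (tree `noetherDifferent_eq_top_of_formallyUnramified`): **`caⁿ(A)B ⊆ caⁿ(B)` for every
  `n ≥ 1` and `ca(A)B ⊆ ca(B)`** — ascent WITH THE SAME INDEX
  (`map_cohomologyAnnihilatorOfDegree_le_of_formallyUnramified`, `map_cohomologyAnnihilator_le_of_formallyUnramified`);
* base change along a finite separable field extension `L/k` of a noetherian `k`-algebra `A`:
  `caⁿ(A)(A ⊗ₖ L) ⊆ caⁿ(A ⊗ₖ L)`, and together with the split pull-back of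
  `…GlobalisationK51CaPullback` the EQUALITY `(caⁿ(A ⊗ₖ L)) ∩ A = caⁿ(A)`
  (`map_cohomologyAnnihilatorOfDegree_le_baseChange`, `comap_cohomologyAnnihilatorOfDegree_baseChange_eq`);
* a monogenic free extension `B = P[θ]`, `g(θ) = 0`: `g'(θ) · caᵈ⁺¹(P)B ⊆ caᵈ⁺¹(B)`
  (`aeval_derivative_mul_mem_cohomologyAnnihilatorOfDegree`) — the standard-étale building block (after
  inverting `g'(θ)`, tree `map_cohomologyAnnihilatorOfDegree_le_of_isLocalization` finishes the ascent).

Proof of the lemma: for finitely generated `B`-modules `M`, `N` and `K = Ωᵈ_B M`, the element `b c`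
(`b ∈ I'ᵈ`, `c ∈ caᵈ⁺¹(A)`) kills `Ext¹_A(K|_A, N|_A)` — induction along the restricted syzygy
sequences exactly as in Lemma 3.3, the base case being `c · Extᵈ⁺¹_A(M|_A, N|_A) = 0` instead of
`gldim A ≤ d` (`mul_mem_annihilator_ext_restrictScalars_of_isSyzygy`); Lemma 3.2 (tree
`noetherDifferent_mul_smul_ext_eq_zero`) upgrades to `x b c · Ext¹_B(K, N) = 0`, and dimension shifting
over `B` concludes. ∎

Why the cell wants it (memo §2): the rational-stage programme M-rat for `PersistenceSurface` imports
Wunram / Gustavsen–Ile over an algebraically closed residue field and a henselian base; the legs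
`T → T ⊗ₖ k'` (`k'/k` finite separable) and — via standard-étale neighbourhoods and a colimit — `T → Tʰ`,
`T → T^{sh}` preserve `caⁿ` by this file, while purely inseparable base change does NOT (a field
`k(a^{1/p})` is regular but `k(a^{1/p}) ⊗ₖ k^{1/p}` is not reduced), which is where gap (g1) of
`L/res-L1-w44b-tri-1/LIT-Esur.md` genuinely lives.

## References

* S. B. Iyengar, R. Takahashi, *Annihilation of cohomology and strong generation of module
  categories*, IMRN 2016; arXiv:1404.1476 — Lemma 3.2, Lemma 3.3, Prop. 3.4. [`IyengarTakahashi2014`]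
* M. Auslander, O. Goldman, *The Brauer group of a commutative ring*, Trans. AMS 97 (1960) — separable
  algebras (noether different `(1)`).
-/

noncomputable section

open CategoryTheory CategoryTheory.Abelian CategoryTheory.Limits
open scoped TensorProduct Polynomial

universe u

namespace Summit.ResolutionOfSingularities.ResolutionOfSingularities.Theorems.HomologicalConductor.PersistenceEtaleAscent

open Literature.RingTheory.CohomologyAnnihilator
open Summit.ResolutionOfSingularities.ResolutionOfSingularities.Theorems.HomologicalConductor.PersistenceHypersurfaceJacobian

/-! ## The relative Lemma 3.3 -/

section Relative

variable {A : Type u} [CommRing A] {B : Type u} [CommRing B] [Algebra A B]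

/-- **Relative Lemma 3.3 (OURS).** Let `B` be module-finite over the noetherian ring `A`,
`I' = ann_A Ext^{≥1}_A(B, mod A)`, `c ∈ caⁿ(A)`. For finitely generated `B`-modules `M`, `N`, an `i`-th
syzygy `K = Ωⁱ_B M` over `B`, `i + j = n` with `j ≥ 1`, and `b ∈ I'ⁱ`: `b c` kills `Extʲ_A(K|_A, N|_A)`.
Induction on `i` along the restricted (still exact) sequences `0 → Ωⁱ⁺¹M → P → ΩⁱM → 0`: in
`Extʲ_A(P, N) → Extʲ_A(Ωⁱ⁺¹M, N) → Extʲ⁺¹_A(ΩⁱM, N)` the right-hand module is killed by `I'ⁱ c`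
(induction), the left-hand one by `I'` (`P` is a summand of `Bʳ`); the base case `i = 0` is
`c · Extⁿ_A(M|_A, N|_A) = 0` (`M|_A`, `N|_A` are finitely generated over `A`). [OURS · L1 w44b] -/
theorem mul_mem_annihilator_ext_restrictScalars_of_isSyzygy [IsNoetherianRing A] [Module.Finite A B]
    {n : ℕ} {c : A} (hc : c ∈ cohomologyAnnihilatorOfDegree A n)
    (M N : ModuleCat.{u} B) [Module.Finite B M] [Module.Finite B N] :
    ∀ (i : ℕ) {j : ℕ}, i + j = n → 1 ≤ j → ∀ {K : ModuleCat.{u} B}, IsSyzygy i M K →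
      ∀ {b : A}, b ∈ extAnnihilatorFrom ((restrictScalarsFunctor A B).obj (ModuleCat.of B B)) 1 ^ i →
        b * c ∈ Module.annihilator A
          (Ext.{u} ((restrictScalarsFunctor A B).obj K) ((restrictScalarsFunctor A B).obj N) j) := by
  set R := restrictScalarsFunctor A B
  haveI : Module.Finite A (R.obj N) := finite_restrictScalars N
  intro i
  induction i with
  | zero =>
    intro j hij _ K hK b _
    obtain ⟨e⟩ := hK
    haveI : Module.Finite B K :=
      Module.Finite.equiv (M := M) e.symm.toLinearEquiv
    haveI : Module.Finite A (R.obj K) := finite_restrictScalars K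
    rw [Module.mem_annihilator]
    intro x
    rw [zero_add] at hij
    subst hij
    rw [mul_smul, smul_eq_zero_of_mem_cohomologyAnnihilatorOfDegree hc le_rfl x, smul_zero]
  | succ i ih =>
    intro j hij hj K hK b hb
    obtain ⟨K', P, hK', hPfin, hP, f, g, w, hS⟩ := hK
    haveI : Module.Finite B P := hPfin
    haveI : Projective P := hP
    let SA : ShortComplex (ModuleCat.{u} A) :=
      ShortComplex.mk (R.map f) (R.map g) (by rw [← Functor.map_comp, w, Functor.map_zero])
    have hSA : SA.ShortExact := hS.map_of_exact R
    have ih' : ∀ {m : A}, m ∈ extAnnihilatorFrom (R.obj (ModuleCat.of B B)) 1 ^ i →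
        m * c ∈ Module.annihilator A (Ext.{u} (R.obj K') (R.obj N) (j + 1)) :=
      fun hm => ih (j := j + 1) (by omega) (by omega) hK' hm
    rw [pow_succ] at hb
    refine Submodule.mul_induction_on hb (fun m hm a ha => ?_) (fun y z hy hz => ?_)
    · rw [Module.mem_annihilator]
      intro x
      -- `δ ((m c) x) = (m c) δ x = 0`, so `(m c) x` comes from `Extʲ_A(P, N)`, which `a` kills
      have hδ : hSA.extClass.comp ((m * c) • x) (add_comm 1 j) = 0 := by
        rw [Ext.comp_smul]
        exact Module.mem_annihilator.mp (ih' hm) _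
      obtain ⟨y, hy⟩ := Ext.contravariant_sequence_exact₁ hSA _ ((m * c) • x) (add_comm 1 j) hδ
      rw [show m * a * c = a * (m * c) by ring, mul_smul, ← hy, ← Ext.comp_smul,
        ext_restrictScalars_smul_eq_zero_of_projective P ha (R.obj N) hj y, Ext.comp_zero]
    · rw [add_mul]
      exact Submodule.add_mem _ hy hz

/-- **Relative Proposition 3.4 (OURS), elementwise.** Let `B` be module-finite over the noetherian ring
`A`, `I' = ann_A Ext^{≥1}_A(B, mod A)`, `x ∈ 𝔑(B/A)`, `b ∈ I'ᵈ` and `c ∈ caᵈ⁺¹(A)`. Then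
`x · (b c) ∈ caᵈ⁺¹(B)`: for finitely generated `M`, `N` and `K = Ωᵈ_B M`, `b c` kills `Ext¹_A(K, N)`
(relative Lemma 3.3), so `x b c` kills `Ext¹_B(K, N)` (Lemma 3.2, tree
`noetherDifferent_mul_smul_ext_eq_zero`), hence `Extᵈ⁺¹_B(M, N)` (dimension shifting, tree
`ext_smul_eq_zero_of_isSyzygy_of_forall`). Iyengar–Takahashi's Prop. 3.4 is the case `caᵈ⁺¹(A) = A`,
`c = 1`. [OURS · L1 w44b] -/
theorem noetherDifferent_mul_mem_cohomologyAnnihilatorOfDegree_of_mem [IsNoetherianRing A]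
    [Module.Finite A B] {d : ℕ} {x : B} (hx : x ∈ noetherDifferent A B) {b : A}
    (hb : b ∈ extAnnihilatorFrom ((restrictScalarsFunctor A B).obj (ModuleCat.of B B)) 1 ^ d)
    {c : A} (hc : c ∈ cohomologyAnnihilatorOfDegree A (d + 1)) :
    x * algebraMap A B (b * c) ∈ cohomologyAnnihilatorOfDegree B (d + 1) := by
  haveI : IsNoetherianRing B := isNoetherian_of_tower A inferInstance
  rw [mem_cohomologyAnnihilatorOfDegree_iff_of_isNoetherianRing]
  intro M N hM hN e
  obtain ⟨K, _, hK⟩ := exists_isSyzygy M d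
  have h1 : ∀ N' : ModuleCat.{u} B, Module.Finite B N' →
      ∀ e' : Ext.{u} K N' 1, (x * algebraMap A B (b * c)) • e' = 0 := by
    intro N' hN' e'
    refine noetherDifferent_mul_smul_ext_eq_zero K N' hx (fun e'' => ?_) e'
    exact Module.mem_annihilator.mp
      (mul_mem_annihilator_ext_restrictScalars_of_isSyzygy hc M N' d (j := 1) rfl le_rfl hK hb) e''
  have := ext_smul_eq_zero_of_isSyzygy_of_forall d hK h1 N hN
  rw [add_comm] at this
  exact this e

/-- **Relative Proposition 3.4 for a projective algebra (OURS).** If moreover `B` is projective over `A`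
(so `I' = A`, tree `extAnnihilatorFrom_restrictScalars_eq_top`), then `x · c ∈ caᵈ⁺¹(B)` for
`x ∈ 𝔑(B/A)`, `c ∈ caᵈ⁺¹(A)`. [OURS · L1 w44b] -/
theorem noetherDifferent_mul_mem_cohomologyAnnihilatorOfDegree_of_projective [IsNoetherianRing A]
    [Module.Finite A B] [Module.Projective A B] {d : ℕ} {x : B} (hx : x ∈ noetherDifferent A B)
    {c : A} (hc : c ∈ cohomologyAnnihilatorOfDegree A (d + 1)) :
    x * algebraMap A B c ∈ cohomologyAnnihilatorOfDegree B (d + 1) := by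
  have h1 : (1 : A) ∈
      extAnnihilatorFrom ((restrictScalarsFunctor A B).obj (ModuleCat.of B B)) 1 ^ d := by
    rw [extAnnihilatorFrom_restrictScalars_eq_top, Ideal.top_pow]
    exact Submodule.mem_top
  have h := noetherDifferent_mul_mem_cohomologyAnnihilatorOfDegree_of_mem hx h1 hc
  rwa [one_mul] at h

/-- **Ideal form (OURS):** `𝔑(B/A) · caᵈ⁺¹(A)B ⊆ caᵈ⁺¹(B)` for `B` module-finite and projective over
the noetherian ring `A`. [OURS · L1 w44b] -/
theorem noetherDifferent_mul_map_le_cohomologyAnnihilatorOfDegree [IsNoetherianRing A]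
    [Module.Finite A B] [Module.Projective A B] (d : ℕ) :
    noetherDifferent A B * (cohomologyAnnihilatorOfDegree A (d + 1)).map (algebraMap A B) ≤
      cohomologyAnnihilatorOfDegree B (d + 1) := by
  rw [Ideal.mul_le]
  intro x hx y hy
  refine Submodule.span_induction (p := fun y _ => x * y ∈ cohomologyAnnihilatorOfDegree B (d + 1))
    ?_ ?_ ?_ ?_ hy
  · rintro _ ⟨c, hc, rfl⟩
    exact noetherDifferent_mul_mem_cohomologyAnnihilatorOfDegree_of_projective hx hc
  · rw [mul_zero]; exact Ideal.zero_mem _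
  · intro y z _ _ hy hz
    rw [mul_add]
    exact Ideal.add_mem _ hy hz
  · intro b y _ hy
    rw [smul_eq_mul, mul_left_comm]
    exact Ideal.mul_mem_left _ b hy

/-! ## Separable (noether different `(1)`) projective algebras: ascent with the same index -/

/-- **Ascent of `caⁿ` along a module-finite projective algebra with `𝔑(B/A) = B` (OURS).** For `B`
module-finite and projective over the noetherian ring `A` with unit noether different (a SEPARABLE
projective algebra in the sense of Auslander–Goldman), `caᵈ⁺¹(A)B ⊆ caᵈ⁺¹(B)`. [OURS · L1 w44b] -/
theorem map_cohomologyAnnihilatorOfDegree_le_of_noetherDifferent_eq_top [IsNoetherianRing A]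
    [Module.Finite A B] [Module.Projective A B] (htop : noetherDifferent A B = ⊤) (d : ℕ) :
    (cohomologyAnnihilatorOfDegree A (d + 1)).map (algebraMap A B) ≤
      cohomologyAnnihilatorOfDegree B (d + 1) := by
  have h := noetherDifferent_mul_map_le_cohomologyAnnihilatorOfDegree (A := A) (B := B) d
  rwa [htop, Ideal.top_mul] at h

/-- Elementwise version: `c ∈ caᵈ⁺¹(A) ⟹ algebraMap A B c ∈ caᵈ⁺¹(B)` when `𝔑(B/A) = B`, `B`
module-finite projective over noetherian `A`. [OURS · L1 w44b] -/
theorem algebraMap_mem_cohomologyAnnihilatorOfDegree_of_noetherDifferent_eq_top [IsNoetherianRing A]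
    [Module.Finite A B] [Module.Projective A B] (htop : noetherDifferent A B = ⊤) {d : ℕ} {c : A}
    (hc : c ∈ cohomologyAnnihilatorOfDegree A (d + 1)) :
    algebraMap A B c ∈ cohomologyAnnihilatorOfDegree B (d + 1) := by
  have h := noetherDifferent_mul_mem_cohomologyAnnihilatorOfDegree_of_projective (A := A) (B := B)
    (x := 1) (by rw [htop]; exact Submodule.mem_top) hc
  rwa [one_mul] at h

/-- **Ascent of the full cohomology annihilator (OURS):** `ca(A)B ⊆ ca(B)` when `𝔑(B/A) = B`, `B`
module-finite projective over noetherian `A` (an element of `caⁿ(A)` lies in `caⁿ⁺¹(A)`, whose image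
lies in `caⁿ⁺¹(B) ⊆ ca(B)`). [OURS · L1 w44b] -/
theorem map_cohomologyAnnihilator_le_of_noetherDifferent_eq_top [IsNoetherianRing A]
    [Module.Finite A B] [Module.Projective A B] (htop : noetherDifferent A B = ⊤) :
    (cohomologyAnnihilator A).map (algebraMap A B) ≤ cohomologyAnnihilator B := by
  rw [Ideal.map_le_iff_le_comap]
  intro c hc
  rw [Ideal.mem_comap]
  obtain ⟨n, hn⟩ := mem_cohomologyAnnihilator_iff.mp hc
  have hn' : c ∈ cohomologyAnnihilatorOfDegree A (n + 1) :=
    cohomologyAnnihilatorOfDegree_mono (Nat.le_succ n) hn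
  exact cohomologyAnnihilatorOfDegree_le (n + 1)
    (algebraMap_mem_cohomologyAnnihilatorOfDegree_of_noetherDifferent_eq_top htop hn')

/-- **Finite étale ascent (OURS).** If `B` is module-finite, projective and formally unramified over the
noetherian ring `A` (e.g. a FINITE ÉTALE `A`-algebra), then `caᵈ⁺¹(A)B ⊆ caᵈ⁺¹(B)`: the noether
different of a formally unramified algebra essentially of finite type is `(1)` (tree
`noetherDifferent_eq_top_of_formallyUnramified`). [OURS · L1 w44b] -/
theorem map_cohomologyAnnihilatorOfDegree_le_of_formallyUnramified [IsNoetherianRing A]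
    [Module.Finite A B] [Module.Projective A B] [Algebra.EssFiniteType A B]
    [Algebra.FormallyUnramified A B] (d : ℕ) :
    (cohomologyAnnihilatorOfDegree A (d + 1)).map (algebraMap A B) ≤
      cohomologyAnnihilatorOfDegree B (d + 1) :=
  map_cohomologyAnnihilatorOfDegree_le_of_noetherDifferent_eq_top
    (noetherDifferent_eq_top_of_formallyUnramified A B) d

/-- **Finite étale ascent for `ca` (OURS):** `ca(A)B ⊆ ca(B)` under the same hypotheses. [OURS · L1 w44b] -/
theorem map_cohomologyAnnihilator_le_of_formallyUnramified [IsNoetherianRing A]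
    [Module.Finite A B] [Module.Projective A B] [Algebra.EssFiniteType A B]
    [Algebra.FormallyUnramified A B] :
    (cohomologyAnnihilator A).map (algebraMap A B) ≤ cohomologyAnnihilator B :=
  map_cohomologyAnnihilator_le_of_noetherDifferent_eq_top
    (noetherDifferent_eq_top_of_formallyUnramified A B)

/-! ## The monogenic (standard-étale) building block -/

/-- **`g'(θ) · caᵈ⁺¹(P) ⊆ caᵈ⁺¹(P[θ])` (OURS).** Let `B` be module-finite and projective over the
noetherian ring `P`, generated as a `P`-algebra by `θ` with `g(θ) = 0`, `g ∈ P[X]` (so every `b ∈ B` is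
`h(θ)` for some `h ∈ P[X]`). Then `g'(θ) · c ∈ caᵈ⁺¹(B)` for every `c ∈ caᵈ⁺¹(P)`, because
`g'(θ) ∈ 𝔑(B/P)` (tree `mul_aeval_derivative_mem_noetherDifferent` with `b₀ = 1`). After inverting
`g'(θ)` (a standard étale neighbourhood) `c` itself lands in `caᵈ⁺¹`, by the localisation ascent of the
tree (`map_cohomologyAnnihilatorOfDegree_le_of_isLocalization`). [OURS · L1 w44b] -/
theorem aeval_derivative_mul_mem_cohomologyAnnihilatorOfDegree {P : Type u} [CommRing P]
    [IsNoetherianRing P] [Algebra P B] [Module.Finite P B] [Module.Projective P B] (θ : B) {g : P[X]}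
    (hg : Polynomial.aeval θ g = 0) (hθ : ∀ b : B, ∃ h : P[X], b = Polynomial.aeval θ h) {d : ℕ}
    {c : P} (hc : c ∈ cohomologyAnnihilatorOfDegree P (d + 1)) :
    Polynomial.aeval θ (Polynomial.derivative g) * algebraMap P B c ∈
      cohomologyAnnihilatorOfDegree B (d + 1) := by
  have hN : algebraMap P B 1 * Polynomial.aeval θ (Polynomial.derivative g) ∈ noetherDifferent P B :=
    mul_aeval_derivative_mem_noetherDifferent θ hg (b₀ := 1) fun b => by
      obtain ⟨h, hh⟩ := hθ b
      exact ⟨h, by rw [one_smul, hh]⟩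
  rw [map_one, one_mul] at hN
  exact noetherDifferent_mul_mem_cohomologyAnnihilatorOfDegree_of_projective hN hc

end Relative

/-! ## Base change along a finite separable field extension -/

section BaseChange

variable (k : Type u) [Field k] (A : Type u) [CommRing A] [Algebra k A] (L : Type u) [Field L]
  [Algebra k L]

/-- **Separable base change, ascent (OURS).** For a noetherian `k`-algebra `A` and a finite separable
field extension `L/k`, `caᵈ⁺¹(A)(A ⊗ₖ L) ⊆ caᵈ⁺¹(A ⊗ₖ L)`: `A ⊗ₖ L` is free of finite rank over `A`
and formally unramified over `A` (base change of the formally unramified `k → L`). [OURS · L1 w44b] -/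
theorem map_cohomologyAnnihilatorOfDegree_le_baseChange [IsNoetherianRing A] [FiniteDimensional k L]
    [Algebra.IsSeparable k L] (d : ℕ) :
    (cohomologyAnnihilatorOfDegree A (d + 1)).map (algebraMap A (A ⊗[k] L)) ≤
      cohomologyAnnihilatorOfDegree (A ⊗[k] L) (d + 1) := by
  haveI : Algebra.FormallyUnramified k L := Algebra.FormallyUnramified.of_isSeparable k L
  haveI : Algebra.FormallyUnramified A (A ⊗[k] L) := inferInstance
  haveI : Module.Finite A (A ⊗[k] L) := inferInstance
  haveI : Module.Projective A (A ⊗[k] L) := inferInstance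
  haveI : Algebra.EssFiniteType A (A ⊗[k] L) := inferInstance
  exact map_cohomologyAnnihilatorOfDegree_le_of_formallyUnramified d

/-- An `A`-linear retraction of `A → A ⊗ₖ L` with `ρ 1 = 1` (tensor a `k`-linear retraction of
`k → L` with `A`). [folklore] -/
theorem exists_retraction_baseChange : ∃ ρ : A ⊗[k] L →ₗ[A] A, ρ 1 = 1 := by
  obtain ⟨r, hr⟩ := LinearMap.exists_leftInverse_of_injective (Algebra.linearMap k L)
    (by rw [LinearMap.ker_eq_bot]; exact (algebraMap k L).injective)
  have hr1 : r 1 = 1 := by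
    have := LinearMap.congr_fun hr (1 : k)
    simpa using this
  refine ⟨(TensorProduct.AlgebraTensorModule.rid k A A).toLinearMap ∘ₗ
    TensorProduct.AlgebraTensorModule.map LinearMap.id r, ?_⟩
  rw [Algebra.TensorProduct.one_def]
  simp [hr1]

/-- **Separable base change, equality (OURS):** for a noetherian `k`-algebra `A` with `A ⊗ₖ L`
noetherian (e.g. `A` essentially of finite type over `k`) and `L/k` finite separable,
`(caᵈ⁺¹(A ⊗ₖ L)) ∩ A = caᵈ⁺¹(A)` — ascent by `map_cohomologyAnnihilatorOfDegree_le_baseChange`, descent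
by the split pull-back `comap_cohomologyAnnihilatorOfDegree_le` of `…GlobalisationK51CaPullback` (the
retraction of `exists_retraction_baseChange`). [OURS · L1 w44b] -/
theorem comap_cohomologyAnnihilatorOfDegree_baseChange_eq [IsNoetherianRing A]
    [IsNoetherianRing (A ⊗[k] L)] [FiniteDimensional k L] [Algebra.IsSeparable k L] (d : ℕ) :
    (cohomologyAnnihilatorOfDegree (A ⊗[k] L) (d + 1)).comap (algebraMap A (A ⊗[k] L)) =
      cohomologyAnnihilatorOfDegree A (d + 1) := by
  haveI : Module.Projective A (A ⊗[k] L) := inferInstance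
  obtain ⟨ρ, hρ⟩ := exists_retraction_baseChange k A L
  refine le_antisymm (K51CaPullback.comap_cohomologyAnnihilatorOfDegree_le ρ hρ d) ?_
  rw [← Ideal.map_le_iff_le_comap]
  exact map_cohomologyAnnihilatorOfDegree_le_baseChange k A L d

end BaseChange

end Summit.ResolutionOfSingularities.ResolutionOfSingularities.Theorems.HomologicalConductor.PersistenceEtaleAscent

end
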